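import Summits.HodgeConjecture.HodgeConjecture.Theorems.H413SpectrumInterfaces
import Summits.HodgeConjecture.HodgeConjecture.Theorems.F0P3StubS5Fold
import Summits.HodgeConjecture.HodgeConjecture.Theorems.H413SpectrumJunctionPin
import Summits.HodgeConjecture.HodgeConjecture.Theorems.H413CohFormsL2
import Literature.NumberTheory.Automorphic.UnitaryGroupCotangentSpectralProjection
import Literature.NumberTheory.Automorphic.UnitaryGroupCohomologicalFormsSmooth
import HarnessLib

/-!
# Crux `H413`, programme P2 — THE U2′ FOLD ON THE DETECTION ROUTE: `StubU2CohFormsSpectrumIsThetaAt` from the engine letters and the continuity of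
# cotangent forms (seat F0P2-p03; F0P2-plan (g0) ruling 2026-08-30T22:16:17Z, F0P3-plan (g0) 22:08:35Z)

HC_CM is proved only modulo the 7 printed citations until rung 0 closes.

TARGET = the parent stub U2′ of the P2 line of record, `SpectrumInterfaces.StubU2CohFormsSpectrumIsThetaAt` (★ `Theorems/H413SpectrumInterfaces.lean`, BY NAME):
«at every face, every irreducible `σ` of `U(V)(𝔸_{F⁺,f})` occurring in the `(1,0) ⊕ (0,1)` cotangent forms `cohForms 𝔞₀` (`𝔞₀ = archFactorOf F V`) is Hecke-related at
some compact open level to a genuine weight-one `ω_V(t)`, `ε` global».  THE CHAIN (this file is its composition; every deep step is a NAMED hypothesis):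
1. `σ` is smooth (★ `CotangentForms.isSmooth_of_equivariant_of_le_smoothFun`, `cohForms ≤ smoothFun`);
2. an automorphic measure `μ` on the COMPACT quotient `U(V)(F⁺)\U(V)(𝔸_{F⁺})` exists and `L²(μ) = L²_disc` (★ `F0P3SpectralJunction.exists_isAutomorphicMeasure`,
   ★ `SpectrumJunction.compactSpace_automorphicQuotient_adelicDatum`, `4 ≤ [F:ℚ]`);
3. J1′ (★ `F0P3SpectralJunction.exists_discreteAutomorphicRep_of_equivariant_cohForms`, over the continuity of cotangent forms ★ `CohFormsL2`): some discrete automorphic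
   `P ≤ L²(μ)` has finite component `σ` (`P.HasFinComponent σ`) and is NOT ORTHOGONAL to the class of a coordinate `[θ w · j]` of a value of `θ`;
4. `θ w ∈ cohForms = holCotForms ⊔ conj holCotForms` splits as `A + B`, the class splits accordingly (`MemLp.toLp_add`), so `P` is not orthogonal to `[A · j]` or to
   `[B · j]`; the SPECTRAL-PROJECTION letter (D) (★ `CotangentForms.holCotFormSpectralProjection` ∕ `antiholCotFormSpectralProjection`, BY NAME as hypotheses `hD` ∕ `hD'`:
   the projection onto `P` of the classes of a (anti)holomorphic cotangent form are the classes of one) turns this into `P.IsHolCotangentAt ∨ P.IsAntiholCotangentAt` at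
   `(𝔞₀.ιinf, 𝔞₀.Kc) = (cmArchSection …, cmCompactFactor …)` (`rfl`): the projected form is non-zero (★ `F0P3HilbertProjection.orthogonalProjectionOnto_ne_zero`) and contained
   in `P` (★ `F0P3StubS5Fold.exists_ne_zero_containsForm_of_classes`);
5. the THETA BRIDGE `hB` (programme P2's pin bridge, seat F0P2-p02, `Theorems/H413ThetaPinBridge.lean`: engine letter (C) ★ `Rogawski1990.cohFinComponent_isTheta` applied at
   the pin's frame data + the line-class transport (C′) `rhoAtLine_lineClassTransport` + ★ `exists_heckeRelated_of_intertwiningMap`) turns «`P` cohomological of type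
   `(1,0)` or `(0,1)` with finite component `σ`» into the conclusion of `SpectrumIsThetaAtLevel` at the face: a compact open `K` and a genuine weight-one triple `t` with
   `HeckeRelatedAt K σ (rhoTriple (datum413 …) t)`.
Hypotheses: the letters (D) BY NAME (`hD`, `hD'`), and the bridge `hB` carried as a TYPE until F0P2-p02's `Theorems/H413ThetaPinBridge.lean ::
ThetaPinBridge.spectrumIsTheta_of_cohFinComponent (hC) (hC′)` is ★ (then a three-line corollary discharges it).  The continuity of cotangent forms is ★
`CohFormsL2.continuous_apply_of_mem_cohForms` (F0P2-p01).  No multiplicity-one input, no inner-product formula, no sign rule enters.  Irreducibility of `σ` is used twice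
(smoothness; injectivity of the finite-component intertwiner inside J1′).

## References
* [BorelJacquet1979] A. Borel, H. Jacquet, Corvallis PSPM 33.1 (1979), §4.2, §4.3, §4.6.  [GelfandGraevPiatetskiShapiro1969] Ch. 1 §2.3.
* [Rogawski1990] J. Rogawski, Ann. of Math. Stud. 123, §12.3 p. 174, Thm. 13.3.6 (c), §14.6, §15.3.  [GelbartRogawski1991] Thm. 5.1.1 p. 465, Lem. 5.1.2 p. 466.
* [Liu2021] Y. Liu, arXiv:2102.11518, proof of Prop. 4.13 l. 2131–2146, Rem. 4.14, App. D Lem. D.1.  [Borel1997] Thm. 2.13, §8.4 (regularity behind (D)).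
* Tree: ★ `Theorems/H413SpectrumInterfaces` (U2′ type, `SpectrumIsThetaAtLevel`, `OccursIn`, `HeckeRelatedAt`, `IsGlobalEps`), ★ `Theorems/F0P3SpectralJunction` (J1′ at the
  carriers, F0P3-p02) + ★ `Theorems/F0P3StubS5Fold` (`two_le_finrank_maximalRealSubfield`, `exists_ne_zero_containsForm_of_classes`), ★ `Theorems/H413SpectrumJunction(Pin)`
  (`toQuotFun` calculus, `rfl` transports, F0P3-p04), ★ `Theorems/H413CohFormsL2` (continuity, F0P2-p01), ★ `Literature/…/UnitaryGroupCohomologicalForms` ((A): `toQuotFun`,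
  `IsHolCotangentAt`, `HasFinComponent`, `cmArchSection`, `cmCompactFactor`), ★ `…/UnitaryGroupCotangentSpectralProjection` (letter (D)), ★ `…/UnitaryGroupCohomologicalFormsSmooth`.
-/

set_option autoImplicit false

-- the mandated namespace has the single-problem summit's repeated segment (`HodgeConjecture.HodgeConjecture`)
set_option linter.dupNamespace false

noncomputable section

namespace Summit.HodgeConjecture.HodgeConjecture.Cruxes.H413.P2StubU2OfLetters

open scoped TensorProduct Matrix InnerProductSpace ENNReal ComplexOrder
open MeasureTheory
open NumberField NumberField.InfinitePlace IsDedekindDomain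
open HodgeCM.Model HodgeCM.Model.LiuIndex HodgeCM.Model.TowerCarrier
open Summit.HodgeConjecture.CorCM.Model
open Literature.AlgebraicGeometry.Motives (CMType AbelianVariety)
open Literature.AlgebraicGeometry.ShimuraVarieties Literature.AlgebraicGeometry.ShimuraVarieties.UnitaryCanonicalModel
open Literature.NumberTheory.Automorphic
open Literature.NumberTheory.Automorphic.Liu2021 Literature.NumberTheory.Automorphic.Liu2021.AppendixC
open Literature.NumberTheory.GelbartRogawski1991 Literature.NumberTheory.GelbartRogawski1991.UnitaryDualPair
open Literature.RepresentationTheory Literature.RepresentationTheory.Liu2021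
open Summit.HodgeConjecture.CorCM
open Literature.NumberTheory.GelbartRogawski1991.OscillatorTripleDictionary (rhoTriple)
open Literature.Geometry.ComplexHyperbolic.BallModel (U21 x₀)
open Summit.HodgeConjecture.CorCM.Lines.A3Liu413 (datum413)
open Summit.HodgeConjecture.HodgeConjecture.Cruxes.H413.CohFormsCarriers
open Literature.NumberTheory.Automorphic.UnitaryGroup
open Literature.NumberTheory.Automorphic.UnitaryGroup.CotangentForms (toQuotFun cmArchSection cmCompactFactor cohForms_le_smoothFun
  isSmooth_of_equivariant_of_le_smoothFun holCotFormSpectralProjection antiholCotFormSpectralProjection)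
open Summit.HodgeConjecture.HodgeConjecture.Cruxes.H413.F0P3SpectralJunction
open Summit.HodgeConjecture.HodgeConjecture.Cruxes.H413.F0P3StubS5Fold (two_le_finrank_maximalRealSubfield exists_ne_zero_containsForm_of_classes)
open Summit.HodgeConjecture.HodgeConjecture.Cruxes.H413.F0P3HilbertProjection (orthogonalProjectionOnto_ne_zero)
open Summit.HodgeConjecture.HodgeConjecture.Cruxes.H413.CohFormsL2 (continuous_apply_of_mem_cohForms)
open Summit.HodgeConjecture.HodgeConjecture.Cruxes.H413.SpectrumJunction (continuous_toQuotFun cohForms_eq_generic compactSpace_automorphicQuotient_adelicDatum)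
open Summit.HodgeConjecture.HodgeConjecture.Cruxes.H413.SpectrumInterfaces

set_option synthInstance.maxHeartbeats 400000 in
set_option maxHeartbeats 8000000 in
/-- **THE U2′ FOLD — `StubU2CohFormsSpectrumIsThetaAt` (BY NAME) from the spectral-projection letter (D) (★ `holCotFormSpectralProjection`, ★ `antiholCotFormSpectralProjection`,
BY NAME) and the theta pin bridge `hB`** (F0P2-p02's `ThetaPinBridge.spectrumIsTheta_of_cohFinComponent`, which consumes ★ `Rogawski1990.cohFinComponent_isTheta` and the line-class
transport (C′); carried here as its TYPE).  Continuity of cotangent forms = ★ `CohFormsL2.continuous_apply_of_mem_cohForms`.  Proof = module docstring steps 1–5.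
[cite: BorelJacquet1979, §4.2, §4.6] [cite: Rogawski1990, Thm. 13.3.6 (c); §15.3; §12.3 p. 174] [cite: GelbartRogawski1991, Thm 5.1.1 p. 465; Lemma 5.1.2 p. 466]
[cite: Liu2021, proof of Prop. 4.13 l. 2131–2146; Rem. 4.14; App. D Lem. D.1] -/
theorem stubU2_of_letters (hD : holCotFormSpectralProjection) (hD' : antiholCotFormSpectralProjection)
    (hB : ∀ (hDel : Literature.AlgebraicGeometry.ShimuraVarieties.UnitaryCanonicalModel.canonicalModel_exists_printed)
      (F : HodgeCM.CMField) [IsGalois ℚ F] (h6 : 6 ≤ Module.finrank ℚ F) {ι₁ : F →+* ℂ} (V : HodgeCM.HermSpace3 F ι₁) (a₀ : RealScalar F)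
      (Φ : CMType F) (hΦ : ι₁ ∈ Φ.1) (i : (I V (repAt a₀) (muLiu ι₁ GramClass.rep)))
      (μ : Measure (adelicDatum F V).automorphicQuotient) [(adelicDatum F V).IsAutomorphicMeasure μ]
      (W : Type) [AddCommGroup W] [Module ℂ W] (σ : Representation ℂ ↥(HodgeCM.HermSpace3.adelicFin V) W),
      σ.IsIrreducible → σ.IsSmooth →
      ∀ P : DiscreteAutomorphicRep (adelicDatum F V) μ,
        (P.IsHolCotangentAt (archFactorOf F V).ιinf (archFactorOf F V).Kc ∨ P.IsAntiholCotangentAt (archFactorOf F V).ιinf (archFactorOf F V).Kc) →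
        P.HasFinComponent σ →
        ∃ K : Subgroup ↥(HodgeCM.HermSpace3.adelicFin V), IsOpen (K : Set ↥(HodgeCM.HermSpace3.adelicFin V)) ∧
          IsCompact (K : Set ↥(HodgeCM.HermSpace3.adelicFin V)) ∧
          ∃ t : (datum413 hDel F V a₀ Φ i).Triple, t.HasWeightOne ∧ IsGlobalEps (datum413 hDel F V a₀ Φ i) t.ε ∧
            HeckeRelatedAt K σ (rhoTriple (datum413 hDel F V a₀ Φ i) t)) :
    StubU2CohFormsSpectrumIsThetaAt := by
  intro hDel F _ h6 ι₁ V a₀ Φ hΦ i _hn W _ _ σ hirr hocc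
  obtain ⟨θ, hθ0, hθA, hθσ⟩ := hocc
  have h4 : 4 ≤ Module.finrank ℚ F := le_trans (by norm_num) h6
  -- `[F⁺:ℚ] ≥ 2` (`[F:ℚ] = 2 [F⁺:ℚ] ≥ 6`): the «genuine inner form» binder of the letters
  have h2 := two_le_finrank_maximalRealSubfield F h6
  -- step 2: an automorphic measure on the compact quotient
  obtain ⟨μ, hμ⟩ := exists_isAutomorphicMeasure (V := V) h4
  haveI := hμ
  haveI := compactSpace_automorphicQuotient_adelicDatum F V h4
  -- step 1: `σ` is smooth
  have hsm : σ.IsSmooth :=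
    isSmooth_of_equivariant_of_le_smoothFun σ hirr _ cohForms_le_smoothFun θ hθ0 (fun w => (cohForms_eq_generic (archFactorOf F V)) ▸ hθA w) hθσ
  -- step 3: J1′
  obtain ⟨P, w, j, h, hu, hfin⟩ := exists_discreteAutomorphicRep_of_equivariant_cohForms h4 μ (archFactorOf F V)
    (continuous_apply_of_mem_cohForms F V h4) σ hirr θ hθσ hθA hθ0
  -- every coordinate of every cotangent form is `L²` (continuity on the compact quotient)
  have hmem : ∀ f ∈ cohForms (archFactorOf F V), ∀ j : Fin 2, MemLp (toQuotFun (adelicDatum F V) fun x => f x j) 2 μ :=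
    fun f hf j => memLp_of_continuous (continuous_toQuotFun (cohForms_left_invariant_apply (archFactorOf F V) hf j) (continuous_apply_of_mem_cohForms F V h4 f hf j))
  -- step 4: split the value `θ w` along `cohForms = holCotForms ⊔ conj holCotForms`
  obtain ⟨A, hA, B, hB', hAB⟩ := Submodule.mem_sup.mp (hθA w)
  have hAc : A ∈ cohForms (archFactorOf F V) := Submodule.mem_sup_left hA
  have hBc : B ∈ cohForms (archFactorOf F V) := Submodule.mem_sup_right hB'
  have hsum : h.toLp (toQuotFun (adelicDatum F V) fun x => θ w x j) =
      (hmem A hAc j).toLp (toQuotFun (adelicDatum F V) fun x => A x j) +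
        (hmem B hBc j).toLp (toQuotFun (adelicDatum F V) fun x => B x j) := by
    rw [← MemLp.toLp_add]
    exact MemLp.toLp_congr _ _ (Filter.EventuallyEq.of_eq (funext fun y => by simp only [toQuotFun, ← hAB, Pi.add_apply]))
  obtain ⟨u, huP, hne⟩ := hu
  have hsplit : ⟪(u : (adelicDatum F V).L2 μ), (hmem A hAc j).toLp (toQuotFun (adelicDatum F V) fun x => A x j)⟫_ℂ ≠ 0 ∨
      ⟪(u : (adelicDatum F V).L2 μ), (hmem B hBc j).toLp (toQuotFun (adelicDatum F V) fun x => B x j)⟫_ℂ ≠ 0 := by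
    by_contra hcon
    push Not at hcon
    apply hne
    rw [hsum, inner_add_right, hcon.1, hcon.2, add_zero]
  -- the letter (D): the projection onto `P` of the (anti)holomorphic summand is a NON-ZERO (anti)holomorphic cotangent form CONTAINED in `P`
  have htype : P.IsHolCotangentAt (archFactorOf F V).ιinf (archFactorOf F V).Kc ∨
      P.IsAntiholCotangentAt (archFactorOf F V).ιinf (archFactorOf F V).Kc := by
    rcases hsplit with hA1 | hB1
    · left
      obtain ⟨Ψ, hΨ, hΨ', heq⟩ := hD (HodgeCM.CMField.K F) ι₁ (HodgeCM.HermSpace3.Hm V) V.sylvesterFrame (HodgeCM.Model.sylvesterFrame_J V)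
        V.posDef_of_ne h2 μ P A hA (hmem A hAc)
      refine exists_ne_zero_containsForm_of_classes P hΨ hΨ' (fun j' => ?_) ⟨j, ?_⟩
      · rw [← heq j']
        exact Submodule.starProjection_apply_mem _ _
      · rw [← heq j, Submodule.starProjection_apply]
        exact Subtype.coe_ne_coe.mpr (orthogonalProjectionOnto_ne_zero P.space ⟨u, huP, hA1⟩)
    · right
      obtain ⟨Ψ, hΨ, hΨ', heq⟩ := hD' (HodgeCM.CMField.K F) ι₁ (HodgeCM.HermSpace3.Hm V) V.sylvesterFrame (HodgeCM.Model.sylvesterFrame_J V)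
        V.posDef_of_ne h2 μ P B hB' (hmem B hBc)
      refine exists_ne_zero_containsForm_of_classes P hΨ hΨ' (fun j' => ?_) ⟨j, ?_⟩
      · rw [← heq j']
        exact Submodule.starProjection_apply_mem _ _
      · rw [← heq j, Submodule.starProjection_apply]
        exact Subtype.coe_ne_coe.mpr (orthogonalProjectionOnto_ne_zero P.space ⟨u, huP, hB1⟩)
  -- step 5: the theta pin bridge
  exact hB hDel F h6 V a₀ Φ hΦ i μ W σ hirr hsm P htype hfin

end Summit.HodgeConjecture.HodgeConjecture.Cruxes.H413.P2StubU2OfLetters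

end
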